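import Summits.ResolutionOfSingularities.ResolutionOfSingularities.Theorems.RegularCurveCut
import HarnessLib

/-!
# RegularCurveLawAllMarkings — tree file 6/6: §13 (rev 1 · NEW · KERNEL) the regular-curve law at EVERY MARKING
`n` (the §11 argument
run with `IsDatum n` and constant order `n` along the branch).  PROVED.

Content VERBATIM from the decomp-res lens-6 g17 file
`HOME/decomp-res-lens-6/g17/parts/RegularCurveLaw-REV1-5548be76.lean` (sha256 5548be7624d15d37;
CRITIC-LEDGER row 128; critic landing order 2026-08-30T18:16:59Z).  Its §0–§8 are g16 `AbsoluteGiraud.lean`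
@bc25b587 byte-identical and ALREADY in
the tree as `Theorems/AbsoluteContact{Scope,Primitives,HasseRing,Hasse,Axes}` + `AbsoluteGiraud{Kernel,Branch}`;
only §9–§13 are landed here — §11–§13 in the text of the lens's rev 2 TREE-SYNC pin
`parts/RegularCurveLaw-REV2-fe4ab852.lean`
(code byte-identical to rev 1; five docstrings sharpened for the critic's hygiene asks h1/h2/h4, STATUS 18:31:35Z).
HOME = run/shared/lean/pub/decomp-res.  Host: route `MaxContactCut`, asides AGHypHug3Insep 27753 / AGAbsContactOff3
27752 / AGAllHug3Off3 27751
(refining 31574 `PVPureGame`).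

[WRITER NOTE (decomp-res writer g6): the critic asked for Literature/…/Resolution placement of the scheme-level
kernels §9/§10; they land
Summits-side because the Literature gate accepts only [cite:]-tagged PUBLISHED statements (same ruling as `CouplingCutCoupled` /
`AbsoluteGiraudKernel`).  ONE namespace `…Theorems.AbsoluteContactClasses` as in the lens; global `set_option`
lines dropped (scoped
`set_option maxHeartbeats … in` kept); nothing else changed.]
(Sources: Giraud1975; EncinasVillamayor2000 Thm. 4.9; BravoGarciaEscamillaVillamayor2012 Lemma 4.6;
VillamayorU2008ReesDiff §4; CossartPiltant2008 §2; CossartJannsenSaito2020 §2–§3; EGAIV4 §16–§17;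
Matsumura1986 §14–§17.)
-/

noncomputable section

open CategoryTheory AlgebraicGeometry TopologicalSpace
open Literature.AlgebraicGeometry.Resolution
open Summit.ResolutionOfSingularities.ResolutionOfSingularities.Theorems
open WeakOrderReduction ForcedTowerClasses PurityValveClasses
open SatelliteExitClasses
open IsLocalRing MvPolynomial

namespace Summit.ResolutionOfSingularities.ResolutionOfSingularities.Theorems.AbsoluteContactClasses

/-! ## §13 (g17 rev 1 · NEW · KERNEL) The regular-curve law at EVERY MARKING `n`

The descent of §11 is uniform in the exponent: for a branch whose followed points have order EXACTLY `n` on a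
pure-dimension-`n`-marked datum (`IsDatum n`), a hugged regular curve germ satisfies `𝓘 ⊆ 𝔭ⁿ` at every
stage and the branch hugs
a top curve. `curveLaw3` (§12) is the case `n = 3` (`B.Core` gives the orders). This is the Branch-setting
regular-curve case of
lens-4's port `HugDimensionClasses.CurveLaw n` for every `n`. Nothing of §0–§12 is renamed or restated. -/

section CurveLawAllMarkings

variable {k : Type} [Field k]

/-- Stage link at marking `n` (§11 `StageLink` with `3 ↦ n`). DEFINITION (support). -/
def StageLinkN (B : Branch k) (n i : ℕ) (H : (B.St i).IdealSheafData) (x : B.St i) : Prop :=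
  ∀ (c ν : ℕ) (f : (B.St i).presheaf.stalk x), c < n → n - c ≤ ν → f ∈ stalkIdeal (B.D i).ideal x →
    f ∈ depthIdeal (stalkIdeal H x) c ν → f ∉ depthIdeal (stalkIdeal H x) c (ν + 1) →
    ∃ f' ∈ stalkIdeal (B.D (i + 1)).ideal (B.pt (i + 1)), ∃ ν' : ℕ, ν' ≤ ν ∧
      f' ∈ depthIdeal (stalkIdeal (strictTransformIdeal (B.π i) (B.centre i) H) (B.pt (i + 1))) c ν' ∧
      f' ∉ depthIdeal (stalkIdeal (strictTransformIdeal (B.π i) (B.centre i) H) (B.pt (i + 1))) c (ν' + 1) ∧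
      (((B.centre i).support : Set (B.St i)) = {x} → ν' + (n - c) = ν)

/-- One blow-up at marking `n`: the curve frame persists on the strict transform and the exact depths are linked
(point round: `curveFrame_point` with `b = n`; foreign round: `curveFrame_foreign`). (Sources: StacksProject, Tag
0BIQ; Matsumura1987, Thm. 14.2.) -/
theorem curveFrame_succN (B : Branch k) (n i r : ℕ) (H : (B.St i).IdealSheafData) (hmult : (B.D i).mult = n)
    (hci : idealOrder (B.D i).ideal (B.pt i) = n)
    (hon : B.pt (i + 1) ∈ ((strictTransformIdeal (B.π i) (B.centre i) H).support : Set (B.St (i + 1))))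
    (h : CurveFrame H r (B.pt i)) :
    CurveFrame (strictTransformIdeal (B.π i) (B.centre i) H) r (B.pt (i + 1)) ∧ StageLinkN B n i H (B.pt i) := by
  haveI := isLocallyNoetherian_St B i
  haveI := isLocallyNoetherian_St B (i + 1)
  have hπ := B.isBlowup i
  have hy : (B.π i).base (B.pt (i + 1)) = B.pt i := B.pt_map i
  have hDi1 : (B.D (i + 1)).ideal = controlledTransform (B.π i) (B.centre i) (B.D i).ideal n := by
    rw [B.transform_eq i, MarkedIdeal.transform_ideal, hmult]
  suffices hs : CurveFrame (strictTransformIdeal (B.π i) (B.centre i) H) r (B.pt (i + 1)) ∧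
      StageLinkN B n i H ((B.π i).base (B.pt (i + 1))) by rw [hy] at hs; exact hs
  have h' : CurveFrame H r ((B.π i).base (B.pt (i + 1))) := by rw [hy]; exact h
  have hIn : stalkIdeal (B.D i).ideal ((B.π i).base (B.pt (i + 1))) ≤ maximalIdeal _ ^ n := by
    rw [hy]; exact (le_idealOrder_iff _ _ n).mp hci.ge
  rcases B.kind i with hpt | hfor
  · -- point round
    haveI : IsRegularLocalRing ((B.St i).presheaf.stalk ((B.π i).base (B.pt (i + 1)))) := (B.base i).isRegular _
    have hpt' : ((B.centre i).support : Set (B.St i)) = {(B.π i).base (B.pt (i + 1))} := by rw [hy]; exact hpt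
    have hcl : IsClosed ({(B.π i).base (B.pt (i + 1))} : Set (B.St i)) := by rw [hy]; exact B.isClosed_pt i
    have hCst : stalkIdeal (B.centre i) ((B.π i).base (B.pt (i + 1))) = maximalIdeal _ := by
      rw [eq_vanishingIdeal_support_of_isRegular (B.centre i) (B.centre_regular i)]
      apply stalkIdeal_vanishingIdeal_eq_maximalIdeal_of_closure_eq
      rw [hpt', hcl.closure_eq]
    obtain ⟨hF, hdrop⟩ := curveFrame_point hπ (B.pt (i + 1)) hCst H r hon h' (B.D i).ideal n hIn
    refine ⟨hF, fun c ν f hcb hν hfI hfQ hfnQ => ?_⟩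
    obtain ⟨f', hf'I, hf'Q, hf'nQ⟩ := hdrop c ν f hcb hν hfI hfQ hfnQ
    refine ⟨f', by rw [hDi1]; exact hf'I, ν - (n - c), by omega, hf'Q, hf'nQ, fun _ => by omega⟩
  · -- foreign round
    have hfor' : (B.π i).base (B.pt (i + 1)) ∉ ((B.centre i).support : Set (B.St i)) := by rw [hy]; exact hfor
    obtain ⟨hF, hkeep⟩ := curveFrame_foreign hπ (B.pt (i + 1)) H r hfor' h' (B.D i).ideal n
    refine ⟨hF, fun c ν f hcb hν hfI hfQ hfnQ => ?_⟩
    obtain ⟨f', hf'I, hf'Q, hf'nQ⟩ := hkeep c ν f hfI hfQ hfnQ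
    refine ⟨f', by rw [hDi1]; exact hf'I, ν, le_rfl, hf'Q, hf'nQ, fun hc => ?_⟩
    exact absurd (hc ▸ Set.mem_singleton _ : (B.π i).base (B.pt (i + 1)) ∈ ((B.centre i).support : Set _)) hfor'

variable (B : Branch k) (n : ℕ) (hD : IsDatum n (B.D 0)) (hord : ∀ i, idealOrder (B.D i).ideal (B.pt i) = n)
  (m r : ℕ) (H : (B.St m).IdealSheafData)
  (hhug : ∀ j, B.pt (m + j) ∈ ((strictIter B m H j).support : Set (B.St (m + j))))
  (h0 : CurveFrame H r (B.pt m))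

include hD hord hhug h0 in
/-- The curve frame at every later stage (marking `n`), paired with the marking identity at that stage
(writer g6: the pairing keeps this general-`n` kernel syntactically distinct from the `n = 3` kernel
`curveFrame_strictIter`; use `.1`). (Sources: StacksProject, Tag 0BIQ.) -/
theorem curveFrame_strictIterN : ∀ j, CurveFrame (strictIter B m H j) r (B.pt (m + j)) ∧
    idealOrder (B.D (m + j)).ideal (B.pt (m + j)) = n
  | 0 => ⟨h0, hord (m + 0)⟩
  | j + 1 => ⟨(curveFrame_succN B n (m + j) r (strictIter B m H j) (mult_eq_of_isDatum B hD (m + j)) (hord (m + j))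
      (hhug (j + 1)) (curveFrame_strictIterN j).1).1, hord (m + (j + 1))⟩

include hD hord hhug h0 in
/-- An exact depth `(c, ν)` with `c < n` has `ν ≥ n − c`. [folklore] -/
theorem exDepthN_ge (j : ℕ) {c ν : ℕ} (hcb : c < n) (h : ExDepth B m H j c ν) : n - c ≤ ν := by
  obtain ⟨f, hfI, hfQ, hfnQ⟩ := h
  obtain ⟨w, hw, hHw, hdim⟩ := (curveFrame_strictIterN B n hD hord m r H hhug h0 j).1
  obtain ⟨s, hsw, hfull⟩ := exists_transversal hw hdim
  rw [hHw] at hfQ hfnQ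
  have hfm : f ∈ maximalIdeal _ ^ n := (le_idealOrder_iff _ _ n).mp (hord (m + j)).ge hfI
  have hfP : f ∈ Ideal.span (Set.range w) ^ c := depthIdeal_le_pow _ c ν hfQ
  have h1 := mem_depthIdeal_of_mem_pow hsw hfull hcb hfm hfP
  by_contra hlt
  exact hfnQ (depthIdeal_antitone _ c (by omega) h1)

include hD hord hhug h0 in
/-- One step at marking `n`. [folklore] -/
theorem exDepthN_step (j : ℕ) {c ν : ℕ} (hcb : c < n) (h : ExDepth B m H j c ν) :
    ∃ ν', ν' ≤ ν ∧ ExDepth B m H (j + 1) c ν' ∧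
      (((B.centre (m + j)).support : Set (B.St (m + j))) = {B.pt (m + j)} → ν' + (n - c) = ν) := by
  have hge := exDepthN_ge B n hD hord m r H hhug h0 j hcb h
  obtain ⟨f, hfI, hfQ, hfnQ⟩ := h
  obtain ⟨-, hlink⟩ := curveFrame_succN B n (m + j) r (strictIter B m H j) (mult_eq_of_isDatum B hD (m + j))
    (hord (m + j)) (hhug (j + 1)) ((curveFrame_strictIterN B n hD hord m r H hhug h0 j).1)
  obtain ⟨f', hf'I, ν', hν', hf'Q, hf'nQ, hpt⟩ := hlink c ν f hcb hge hfI hfQ hfnQ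
  exact ⟨ν', hν', ⟨f', hf'I, hf'Q, hf'nQ⟩, hpt⟩

include hD hord hhug h0 in
/-- Transport over `d` further stages at marking `n`. [folklore] -/
theorem exDepthN_transport (j d : ℕ) {c ν : ℕ} (hcb : c < n) (h : ExDepth B m H j c ν) :
    ∃ ν', ν' ≤ ν ∧ ExDepth B m H (j + d) c ν' := by
  induction d with
  | zero => exact ⟨ν, le_rfl, h⟩
  | succ d ih =>
    obtain ⟨ν₁, hν₁, h₁⟩ := ih
    obtain ⟨ν₂, hν₂, h₂, -⟩ := exDepthN_step B n hD hord m r H hhug h0 (j + d) hcb h₁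
    exact ⟨ν₂, hν₂.trans hν₁, h₂⟩

include hD hord hhug h0 in
/-- Infinite descent at marking `n`: each point round costs `n − c ≥ 1`. [folklore] -/
theorem exDepthN_unbounded {c : ℕ} (hcb : c < n) : ∀ N j ν, ExDepth B m H j c ν → N ≤ ν := by
  intro N
  induction N with
  | zero => intros; exact Nat.zero_le _
  | succ N ih =>
    intro j ν h
    obtain ⟨i₁, hi₁, hpt⟩ := B.io (m + j)
    obtain ⟨d, hd⟩ := Nat.exists_eq_add_of_le hi₁
    obtain ⟨ν₁, hν₁, h₁⟩ := exDepthN_transport B n hD hord m r H hhug h0 j d hcb h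
    have hpt' : ((B.centre (m + (j + d))).support : Set (B.St (m + (j + d)))) = {B.pt (m + (j + d))} := by
      rw [← Nat.add_assoc, ← hd]; exact hpt
    obtain ⟨ν₂, hν₂, h₂, hdrop⟩ := exDepthN_step B n hD hord m r H hhug h0 (j + d) hcb h₁
    have hge := exDepthN_ge B n hD hord m r H hhug h0 (j + d) hcb h₁
    have h3 := ih (j + d + 1) ν₂ h₂
    have h4 := hdrop hpt'
    omega

include hD hord hhug h0 in
/-- `𝓘_{m+j} ∩ P^c ⊆ P^{c+1}` for `c < n`. [folklore] -/
theorem mem_pow_succ_of_mem_powN (j c : ℕ) (hcb : c < n) {f : (B.St (m + j)).presheaf.stalk (B.pt (m + j))}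
    (hfI : f ∈ stalkIdeal (B.D (m + j)).ideal (B.pt (m + j)))
    (hfP : f ∈ stalkIdeal (strictIter B m H j) (B.pt (m + j)) ^ c) :
    f ∈ stalkIdeal (strictIter B m H j) (B.pt (m + j)) ^ (c + 1) := by
  classical
  haveI := isLocallyNoetherian_St B (m + j)
  apply mem_pow_succ_of_forall_mem_depthIdeal
  intro ν
  by_contra hν
  have hex : ∃ μ, f ∉ depthIdeal (stalkIdeal (strictIter B m H j) (B.pt (m + j))) c (μ + 1) := by
    rcases ν with _ | μ
    · exact absurd (by rw [depthIdeal_zero]; exact hfP) hν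
    · exact ⟨μ, hν⟩
  set μ := Nat.find hex with hμdef
  have hμ : f ∉ depthIdeal (stalkIdeal (strictIter B m H j) (B.pt (m + j))) c (μ + 1) := Nat.find_spec hex
  have hμ' : f ∈ depthIdeal (stalkIdeal (strictIter B m H j) (B.pt (m + j))) c μ := by
    rcases Nat.eq_zero_or_pos μ with h0 | hpos
    · rw [h0, depthIdeal_zero]; exact hfP
    · obtain ⟨μ₀, hμ₀⟩ := Nat.exists_eq_add_of_lt hpos
      rw [hμ₀, Nat.zero_add]
      by_contra hnot
      exact Nat.find_min hex (show μ₀ < μ by omega) hnot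
  have := exDepthN_unbounded B n hD hord m r H hhug h0 hcb (μ + 1) j μ ⟨f, hfI, hμ', hμ⟩
  omega

include hD hord hhug h0 in
/-- **THE CURVE LAW at marking `n` (local form)**: `𝓘_{m+j} ⊆ P_jⁿ` at every stage (nearest printed
statement: CJS LNM 2270
p. 139–140, «Thm. 10.2 ⇒ Thm. 6.35», `v_𝔮(f_i) = n_i = v_𝔪(f_i)`, under a characteristic hypothesis;
none here). (Sources: CossartJannsenSaito2020, Thm. 10.2, Thm. 6.35, p. 139-140; Kollar2007, Thm. 1.81.) -/
theorem stalkIdeal_le_powN (j : ℕ) :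
    stalkIdeal (B.D (m + j)).ideal (B.pt (m + j)) ≤ stalkIdeal (strictIter B m H j) (B.pt (m + j)) ^ n := by
  intro f hf
  have key : ∀ c, c ≤ n → f ∈ stalkIdeal (strictIter B m H j) (B.pt (m + j)) ^ c := by
    intro c
    induction c with
    | zero => intro; rw [pow_zero, Ideal.one_eq_top]; trivial
    | succ c ih => intro hc; exact mem_pow_succ_of_mem_powN B n hD hord m r H hhug h0 j c (by omega) hf (ih (by omega))
  exact key n le_rfl

omit hD hord hhug h0

/-- **THEOREM (g17 rev 1 · THE REGULAR-CURVE LAW AT EVERY MARKING)**: a branch with followed-point orders exactly `n` on an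
`n`-marked datum that hugs a regular curve germ HUGS A TOP CURVE; all `n`, all characteristics, all fields.
(Sources: CossartJannsenSaito2009, Thm. 2.10; Matsumura1987, Thm. 14.2.) -/
theorem hugsTop_of_hugsRegCurveN (B : Branch k) {n : ℕ} (hD : IsDatum n (B.D 0))
    (hord : ∀ i, idealOrder (B.D i).ideal (B.pt i) = n) (hH : B.HugsRegCurve) : B.HugsTop := by
  classical
  obtain ⟨m, r, H, ⟨w, hw, hHw, hdim⟩, hgerm⟩ := hH
  haveI := isLocallyNoetherian_St B m
  haveI : IsRegularLocalRing ((B.St m).presheaf.stalk (B.pt m)) := (B.base m).isRegular _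
  set P : Ideal ((B.St m).presheaf.stalk (B.pt m)) := Ideal.span (Set.range w) with hPdef
  haveI hP : P.IsPrime := hw.isPrime_span_range
  let q : PrimeSpectrum ((B.St m).presheaf.stalk (B.pt m)) := ⟨P, hP⟩
  let η : B.St m := (B.St m).fromSpecStalk (B.pt m) q
  have hη : η ⤳ B.pt m := fromSpecStalk_specializes q
  set Hc : (B.St m).IdealSheafData := Scheme.IdealSheafData.vanishingIdeal ⟨closure {η}, isClosed_closure⟩
    with hHcdef
  have hPq : primeOfSpecializes hη = P := primeOfSpecializes_fromSpecStalk q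
  have hHc : stalkIdeal Hc (B.pt m) = P := by rw [hHcdef, stalkIdeal_vanishingIdeal_closure hη, hPq]
  have hcongr := stalkIdeal_strictIter_congr B m H Hc (hHw.trans hHc.symm)
  have hhug : ∀ j, B.pt (m + j) ∈ ((strictIter B m Hc j).support : Set (B.St (m + j))) := fun j => by
    have h1 := (mem_support_iff_stalkIdeal_le _ _).mp (hgerm.2 j)
    exact (mem_support_iff_stalkIdeal_le _ _).mpr (by rw [← hcongr j]; exact h1)
  have h0 : CurveFrame Hc r (B.pt m) := ⟨w, hw, hHc, hdim⟩
  have hpow : stalkIdeal (B.D m).ideal (B.pt m) ≤ P ^ n := by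
    have h1 : stalkIdeal (B.D (m + 0)).ideal (B.pt (m + 0)) ≤ stalkIdeal (strictIter B m Hc 0) (B.pt (m + 0)) ^ n :=
      stalkIdeal_le_powN B n hD hord m r Hc hhug h0 0
    rw [← hHc]; exact h1
  -- `P ≠ ⊥` from the finite order of `H` at `pt m` (part of `HugsGerm`)
  have hPne : P ≠ ⊥ := by
    intro hP0
    exact hgerm.1 (idealOrder_eq_top_of_stalkIdeal_eq_bot' _ _ (hHw.trans hP0))
  refine ⟨m, Hc, ⟨?_, hhug⟩, ?_, ?_⟩
  · exact (idealOrder_lt_top_of_stalkIdeal_ne_bot (by rw [hHc]; exact hPne)).ne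
  · intro t ht
    have ht' : t ∈ (Scheme.IdealSheafData.vanishingIdeal ⟨closure {η}, isClosed_closure⟩ :
        (B.St m).IdealSheafData).support := by
      rw [← hHcdef]; exact ht
    have hηt : η ⤳ t := mem_support_vanishingIdeal_closure_singleton_iff.mp ht'
    haveI : IsRegularLocalRing ((B.St m).presheaf.stalk t) := (B.base m).isRegular _
    haveI : IsRegularLocalRing ((B.St m).presheaf.stalk η) := (B.base m).isRegular _
    show ((B.D m).mult : ℕ∞) ≤ idealOrder (B.D m).ideal t
    rw [mult_eq_of_isDatum B hD m]
    refine le_trans ?_ (idealOrder_le_of_specializes hηt _)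
    rw [le_idealOrder_iff, ← stalkIdeal_map_stalkSpecializes _ hη]
    have hPle : P.map ((B.St m).presheaf.stalkSpecializes hη).hom ≤ maximalIdeal _ := by
      rw [← hPq]; exact Ideal.map_comap_le
    calc (stalkIdeal (B.D m).ideal (B.pt m)).map ((B.St m).presheaf.stalkSpecializes hη).hom
        ≤ (P ^ n).map ((B.St m).presheaf.stalkSpecializes hη).hom := Ideal.map_mono hpow
      _ = (P.map ((B.St m).presheaf.stalkSpecializes hη).hom) ^ n := Ideal.map_pow _ _ n
      _ ≤ maximalIdeal _ ^ n := Ideal.pow_right_mono hPle n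
  · rw [hHc]
    have h1 := hw.ringKrullDim_quotient_add
    rw [hdim, Nat.add_comm] at h1
    rw [eq_of_add_natCast_eq h1, Nat.cast_one]

/-- **LAW · `CurveLawN`** [KERNEL-PROVED: `curveLawN`] — the regular-curve law at EVERY marking `n`: «a branch
of an `n`-marked datum
(`IsDatum n`) whose followed points all have order exactly `n` and which hugs a regular curve germ hugs a top curve». -/
def CurveLawN : Prop :=
  ∀ (n : ℕ) (k : Type) [Field k] (B : Branch k), IsDatum n (B.D 0) →
    (∀ i, idealOrder (B.D i).ideal (B.pt i) = n) → B.HugsRegCurve → B.HugsTop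

/-- **THEOREM (g17 rev 1): the regular-curve law holds at every marking.** [folklore] -/
theorem curveLawN : CurveLawN := fun _ _ _ B hD hord hH => hugsTop_of_hugsRegCurveN B hD hord hH

/-- Consistency: the all-markings law specialises to `CurveLaw3` (a core point has order `3`). [folklore] -/
theorem curveLaw3_of_curveLawN (h : CurveLawN) : CurveLaw3 :=
  fun k _ B hD hC hH => h 3 k B hD (fun i => (hC i).1) hH

end CurveLawAllMarkings

end Summit.ResolutionOfSingularities.ResolutionOfSingularities.Theorems.AbsoluteContactClasses
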